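/-
COR-CM (cell pub-hodgecm2, stage 2 of the Hodge ladder) — count-neutral KERNEL COMBINATORICS «μ = φ₂ for EVERY group of order 4pᵏ with a cyclic Sylow
p-subgroup (p odd) and EVERY central involution» (seat prover-pub-hodgecm2-b23-g50-0, binder prover b23, gen 50; own census lane INDEX-TWO CYCLIC 2-GROUPS,
extension «SMALL DEGREES», claim HOME/INBOX.md l.23042, INTERIM #1 l.23124).  Theorems only; `Census/IndexTwoCyclicOddPrime.lean`,
`Census/IndexTwoCyclicNormalForm.lean`, `Census/IndexTwoCyclicOddLevel.lean`, `Census/IndexTwoCyclicTwoGroups.lean` §1 and `Census/IndexTwoCyclicQuaternion.lean`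
(this seat) are used BY NAME.  No definition, no `decide`, no certificate, no named fact, no `sorry`.  `Interfaces.lean` (C1), every E term, B01,
`Transposition/*`, `PortJoin/*`, `D2Bridge/*` untouched.
HONEST FRAMING: `HC_CM` is NOT proved, here or anywhere in the tree; nothing here is a period, a count of record or a headline.
T5: n/a-class (hypothesis binders: `|G| = 4pᵏ`, `p` prime `≠ 2`, `k ≠ 0`, an element of order `pᵏ`, `c·c = 1`, `c ≠ 1`, `c` central — inhabited by `ℤ/36`;
checker: self, 2026-08-25).
-/
import Summits.HodgeConjecture.CorCM.Census.IndexTwoCyclicOddPrime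
import HarnessLib

/-!
# The face census of every group of order `4pᵏ` with a cyclic Sylow `p`-subgroup: `μ(G, c) = φ₂(G, c)`

`Census/IndexTwoCyclicOddPrime.lean` (this seat) settles every group of order `4p`.  The same argument runs at every odd prime-power level: if `|G| = 4pᵏ`
(`p` odd, `k ≥ 1`) and `G` has an element `g` of order `pᵏ` (i.e. the Sylow `p`-subgroup is cyclic — automatic for `k = 1` by Cauchy), then for a central
involution `c` the element `u = g·c` has order `2pᵏ`, `[G : ⟨u⟩] = 2` and `u^{pᵏ} = c` (§2); `r² ≡ 1 (mod 2pᵏ)` forces `r ∈ {1, 2pᵏ − 1}` because `p`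
cannot divide both `r − 1` and `r + 1` (§1); and the level-`pᵏ` trichotomy (§2) lands in the split odd-level law, the cyclic law or seat b09ʼs quaternion
column transported (`Q_{4pᵏ}`), exactly as for `k = 1`:

* §3 **`isLeast_card_gfaces_generate_fibreTwo_of_card_eq_four_mul_prime_pow (hc2) (hc1) (hcen) (hp) (hp2) (hk) (hcard : |G| = 4pᵏ) (g) (hg : ord g = pᵏ)`**
  (§4: the same from any `u` with `[G : ⟨u⟩] = 2`, `…_of_index_two`, the complement law covering `c ∉ ⟨u⟩`):
  `μ(G, c) = φ₂(G, c)` — `ℤ/4pᵏ`, `ℤ/2pᵏ × ℤ/2` (all three `c`), `D_{4pᵏ}`, `Q_{4pᵏ}`; field level: every Galois CM field of degree `4pᵏ` with an automorphism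
  of order `pᵏ` (equivalently: cyclic over some quadratic subfield) has exactly `φ₂(F)` generating faces (`CorCM/FaceIndexTwoCyclicOddPrimePower.lean`).

## References
* [Pohlmann1968] H. Pohlmann, Algebraic cycles on abelian varieties of complex multiplication type, Ann. of Math. 88 (1968), Thm 1.
-/

namespace Summit.HodgeConjecture.CorCM.Census.IndexTwoCyclic

open Finset
open Summit.HodgeConjecture.CorCM.Prior.AllgGroup.RfwfAllgGroup
open Summit.HodgeConjecture.CorCM.Census.BlockParity
open Summit.HodgeConjecture.CorCM.Census.Coinvariant

/-! ## §1 Arithmetic at odd prime-power level: `r² ≡ 1 (mod 2pᵏ) ⟹ r ≡ ±1` -/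

/-- **`r² ≡ 1 (mod 2pᵏ)`, `r < 2pᵏ`, `p` an odd prime, `k ≥ 1` ⟹ `r = 1` or `r = 2pᵏ − 1`** (`p` divides at most one of `r ± 1`). [folklore] -/
theorem eq_one_or_eq_of_sq_modEq_prime_pow {p k r : ℕ} (hp : p.Prime) (hp2 : p ≠ 2) (hk : k ≠ 0) (hr : r < 2 * p ^ k)
    (hrr : r * r ≡ 1 [MOD 2 * p ^ k]) : r = 1 ∨ r + 1 = 2 * p ^ k := by
  have hp1 : 3 ≤ p := by
    have := hp.two_le
    omega
  have hpk : 0 < p ^ k := by positivity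
  have hsq : r * r % 2 = 1 := Nat.ModEq.of_mul_right (p ^ k) hrr
  have hodd : Odd r := (Nat.odd_mul.mp (Nat.odd_iff.mpr hsq)).1
  obtain ⟨m, rfl⟩ := hodd
  have h2p : 2 * p ^ k ∣ (2 * m + 1) * (2 * m + 1) - 1 := (Nat.modEq_iff_dvd' (by nlinarith)).mp hrr.symm
  have e : (2 * m + 1) * (2 * m + 1) - 1 = 2 * (2 * (m * (m + 1))) := by
    have : (2 * m + 1) * (2 * m + 1) = 2 * (2 * (m * (m + 1))) + 1 := by ring
    omega
  rw [e] at h2p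
  have hpm : p ^ k ∣ 2 * (m * (m + 1)) := Nat.dvd_of_mul_dvd_mul_left (by norm_num : 0 < 2) h2p
  have hcop2 : Nat.Coprime (p ^ k) 2 := Nat.Coprime.pow_left k ((Nat.coprime_primes hp Nat.prime_two).mpr hp2)
  have hpm' : p ^ k ∣ m * (m + 1) := hcop2.dvd_of_dvd_mul_left hpm
  by_cases hm : p ∣ m
  · -- then `p ∤ m + 1`, so `pᵏ ∣ m`, `2pᵏ ∣ 2m = r − 1 < 2pᵏ` ⟹ `m = 0`
    have hm1 : ¬ p ∣ m + 1 := fun h => by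
      have := (Nat.dvd_add_right hm).mp h
      exact hp.one_lt.ne' (Nat.dvd_one.mp this)
    have hcop : Nat.Coprime (p ^ k) (m + 1) := Nat.Coprime.pow_left k (hp.coprime_iff_not_dvd.mpr hm1)
    have hdvd : p ^ k ∣ m := hcop.dvd_of_dvd_mul_right hpm'
    left
    rcases Nat.eq_zero_or_pos m with h0 | h0
    · subst h0; rfl
    · exact absurd (Nat.le_of_dvd h0 hdvd) (by omega)
  · -- `p ∤ m` ⟹ `pᵏ ∣ m + 1` ⟹ `2pᵏ ∣ r + 1 ≤ 2pᵏ`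
    have hcop : Nat.Coprime (p ^ k) m := Nat.Coprime.pow_left k (hp.coprime_iff_not_dvd.mpr hm)
    have hdvd : p ^ k ∣ m + 1 := hcop.dvd_of_dvd_mul_left hpm'
    right
    obtain ⟨q, hq⟩ := hdvd
    rcases q with _ | _ | q
    · omega
    · omega
    · nlinarith

/-! ## §2 A cyclic subgroup of index two through a central involution, and the level-`pᵏ` trichotomy -/

/-- **In a group of order `4pᵏ` (`p` odd) with an element `g` of order `pᵏ`, a central involution `c` lies in a cyclic subgroup of index two**: `u = g·c`
has order `2pᵏ`, `[G : ⟨u⟩] = 2` and `u^{pᵏ} = c`. [folklore] -/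
theorem exists_index_two_of_card_eq_four_mul_prime_pow {G : Type*} [Group G] [Fintype G] {c : G} (hc2 : c * c = 1) (hc1 : c ≠ 1)
    (hcen : ∀ x : G, x * c = c * x) {p k : ℕ} (hp : p.Prime) (hp2 : p ≠ 2) (hcard : Fintype.card G = 4 * p ^ k) (g : G)
    (hg : orderOf g = p ^ k) : ∃ u : G, orderOf u = 2 * p ^ k ∧ (Subgroup.zpowers u).index = 2 ∧ u ^ p ^ k = c := by
  haveI : Fact (Nat.Prime 2) := ⟨Nat.prime_two⟩
  have hcomm : Commute g c := hcen g
  have hoc : orderOf c = 2 := orderOf_eq_prime (by rw [pow_two, hc2]) hc1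
  have hcop : (orderOf g).Coprime (orderOf c) := by
    rw [hg, hoc]
    exact Nat.Coprime.pow_left k ((Nat.coprime_primes hp Nat.prime_two).mpr hp2)
  have hord : orderOf (g * c) = 2 * p ^ k := by
    rw [hcomm.orderOf_mul_eq_mul_orderOf_of_coprime hcop, hg, hoc, mul_comm]
  have hpk : 0 < p ^ k := by have := hp.pos; positivity
  refine ⟨g * c, hord, ?_, ?_⟩
  · have h := (Subgroup.zpowers (g * c)).card_mul_index
    rw [Nat.card_zpowers, hord, Nat.card_eq_fintype_card, hcard] at h
    have : 2 * p ^ k * (Subgroup.zpowers (g * c)).index = 2 * p ^ k * 2 := by rw [h]; ring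
    exact Nat.eq_of_mul_eq_mul_left (by omega) this
  · obtain ⟨m, hm⟩ : Odd (p ^ k) := (hp.odd_of_ne_two hp2).pow
    have hgp : g ^ p ^ k = 1 := by rw [← hg]; exact pow_orderOf_eq_one g
    rw [hcomm.mul_pow, hgp, one_mul, hm, pow_succ, pow_mul, pow_two, hc2, one_pow, one_mul]

/-- **THE LEVEL-`pᵏ` TRICHOTOMY** (`p` an odd prime, `k ≥ 1`): `u` of order `2pᵏ` with `[G : ⟨u⟩] = 2` ⟹ EITHER some element outside `⟨u⟩` is an
involution, OR `G` is cyclic, OR some `w ∉ ⟨u⟩` satisfies `w² = u^{pᵏ}`, `w u w⁻¹ = u⁻¹`. [folklore] -/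
theorem exists_involution_or_isCyclic_or_quaternion_of_prime_pow {G : Type*} [Group G] [Finite G] (u : G) {p k : ℕ} (hp : p.Prime)
    (hp2 : p ≠ 2) (hk : k ≠ 0) (hord : orderOf u = 2 * p ^ k) (hindex : (Subgroup.zpowers u).index = 2) :
    (∃ w : G, w ∉ Subgroup.zpowers u ∧ w * w = 1) ∨ IsCyclic G ∨
      (∃ w : G, w ∉ Subgroup.zpowers u ∧ w * w = u ^ p ^ k ∧ w * u * w⁻¹ = u⁻¹) := by
  by_cases hinv : ∃ w : G, w ∉ Subgroup.zpowers u ∧ w * w = 1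
  · exact Or.inl hinv
  push Not at hinv
  obtain ⟨w, hw⟩ := exists_notMem_of_index_two hindex
  obtain ⟨r, hr, hwu⟩ := exists_pow_eq_of_mem_zpowers (conj_mem_zpowers_of_index_two hindex w)
  obtain ⟨j, hj, hww⟩ := exists_pow_eq_of_mem_zpowers (mul_self_mem_of_index_two hindex w)
  rw [hord] at hr hj
  have hpk : 0 < p ^ k := by have := hp.pos; positivity
  have hrr : r * r ≡ 1 [MOD 2 * p ^ k] := by
    rw [← hord, ← pow_eq_pow_iff_modEq, pow_one]
    exact pow_r_mul_r_eq hwu.symm hww.symm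
  have hrj : r * j ≡ j [MOD 2 * p ^ k] := by
    rw [← hord, ← pow_eq_pow_iff_modEq]
    exact pow_r_mul_j_eq hwu.symm hww.symm
  have hsq : ∀ i : ℕ, (w * u ^ i) * (w * u ^ i) = u ^ (j + (r + 1) * i) := coset_mul_self hwu.symm hww.symm
  have hout : ∀ i : ℕ, w * u ^ i ∉ Subgroup.zpowers u := fun i h =>
    hw ((Subgroup.mul_mem_cancel_right _ (Subgroup.pow_mem _ (Subgroup.mem_zpowers u) i)).mp h)
  have hno : ∀ i : ℕ, ¬ 2 * p ^ k ∣ j + (r + 1) * i := by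
    intro i hi
    apply hinv (w * u ^ i) (hout i)
    rw [hsq, ← orderOf_dvd_iff_pow_eq_one, hord]
    exact hi
  rcases eq_one_or_eq_of_sq_modEq_prime_pow hp hp2 hk hr hrr with rfl | hr1
  · -- `r = 1`: no involution ⟹ `j` odd ⟹ some `(w uⁱ)² = u^{j+2i}` is prime to `2pᵏ` ⟹ cyclic
    right; left
    have hjodd : Odd j := by
      by_contra hev
      rw [Nat.not_odd_iff_even] at hev
      obtain ⟨j', rfl⟩ := hev
      refine hno ((p ^ k - 1) * j') ⟨j', ?_⟩
      obtain ⟨m, hm⟩ : ∃ m, p ^ k = m + 1 := ⟨p ^ k - 1, by omega⟩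
      rw [hm, Nat.add_sub_cancel]
      ring
    obtain ⟨i, hi⟩ : ∃ i : ℕ, ¬ p ∣ j + (1 + 1) * i := by
      by_cases h0 : p ∣ j
      · refine ⟨1, fun h1 => ?_⟩
        have h2 : p ∣ 2 := (Nat.dvd_add_right h0).mp (by simpa using h1)
        exact hp2 ((Nat.prime_dvd_prime_iff_eq hp Nat.prime_two).mp h2)
      · exact ⟨0, by simpa using h0⟩
    have hcop : (j + (1 + 1) * i).Coprime (orderOf u) := by
      rw [hord]
      refine Nat.Coprime.mul_right ?_ (Nat.Coprime.pow_right k ?_)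
      · exact (Nat.prime_two.coprime_iff_not_dvd.mpr (by obtain ⟨m, hm⟩ := hjodd; omega)).symm
      · exact (hp.coprime_iff_not_dvd.mpr hi).symm
    exact isCyclic_of_mul_self_eq_pow hindex (hout i) (hsq i) hcop
  · -- `r = 2pᵏ − 1`: `r j ≡ j` ⟹ `pᵏ ∣ j` ⟹ `j = pᵏ`: the quaternion relations
    right; right
    have hjj : 2 * p ^ k ∣ j + j := by
      have h : r * j + j ≡ j + j [MOD 2 * p ^ k] := Nat.ModEq.add_right j hrj
      have e : r * j + j = 2 * p ^ k * j := by
        have : r * j + j = (r + 1) * j := by ring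
        rw [this, hr1]
      rw [e] at h
      exact Nat.modEq_zero_iff_dvd.mp (h.symm.trans (Nat.modEq_zero_iff_dvd.mpr (dvd_mul_right _ _)))
    have hjp : j = p ^ k := by
      rcases eq_or_eq_of_dvd_of_le (Nat.dvd_of_mul_dvd_mul_left (by norm_num : 0 < 2) (by simpa [two_mul] using hjj))
        (fun h => hno 0 ⟨0, by simp [h]⟩) (by omega) with h | h
      · exact h
      · omega
    refine ⟨w, hw, by rw [← hww, hjp], ?_⟩
    rw [← hwu]
    apply eq_inv_of_mul_eq_one_left
    rw [← pow_succ, hr1, ← hord, pow_orderOf_eq_one]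

/-! ## §3 The census of every group of order `4pᵏ` with a cyclic Sylow `p`-subgroup -/

/-- **THE FACE CENSUS OF EVERY GROUP OF ORDER `4pᵏ` WITH A CYCLIC SYLOW `p`-SUBGROUP (`p` ODD, `k ≥ 1`): `μ(G, c) = φ₂(G, c)`** for EVERY central involution
`c` — one theorem for `ℤ/4pᵏ`, `ℤ/2pᵏ × ℤ/2` (all three central involutions), `D_{4pᵏ}`, `Q_{4pᵏ}`, classification-free. [folklore] -/
theorem isLeast_card_gfaces_generate_fibreTwo_of_card_eq_four_mul_prime_pow {G : Type*} [Group G] [Fintype G] [DecidableEq G] {c : G}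
    (hc2 : c * c = 1) (hc1 : c ≠ 1) (hcen : ∀ x : G, x * c = c * x) {p k : ℕ} (hp : p.Prime) (hp2 : p ≠ 2) (hk : k ≠ 0)
    (hcard : Fintype.card G = 4 * p ^ k) (g : G) (hg : orderOf g = p ^ k) :
    IsLeast {m : ℕ | ∃ S : Finset (CMF G c →₀ ℤ), ↑S ⊆ gfaceSet G c hc2 ∧ S.card = m ∧
      hodgeSpan c hc2 ≤ Submodule.span ℤ (pairSet c) ⊔ Submodule.span ℤ (translates c S)} (fibreTwo c hc2) := by
  obtain ⟨u, hord, hindex, hun⟩ := exists_index_two_of_card_eq_four_mul_prime_pow hc2 hc1 hcen hp hp2 hcard g hg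
  have hp1 : 3 ≤ p := by
    have := hp.two_le
    omega
  have h2 : 2 ≤ p ^ k := by
    calc 2 ≤ p := by omega
      _ = p ^ 1 := (pow_one p).symm
      _ ≤ p ^ k := Nat.pow_le_pow_right hp.pos (Nat.one_le_iff_ne_zero.mpr hk)
  rcases exists_involution_or_isCyclic_or_quaternion_of_prime_pow u hp hp2 hk hord hindex with ⟨w, hw, hww⟩ | hcyc | ⟨w, hw, hww, hwu⟩
  · exact isLeast_card_gfaces_generate_fibreTwo_of_involution_odd hc2 hc1 u w (hp.odd_of_ne_two hp2).pow hun hord hindex hw hww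
  · haveI : IsCyclic G := hcyc
    exact isLeast_card_gfaces_generate_fibreTwo_of_isCyclic hc2 hc1
  · exact isLeast_card_gfaces_generate_fibreTwo_of_quaternion hc2 u w hun hord hindex hw (hww.trans hun) hwu h2

/-! ## §4 From an element generating a subgroup of index two (any central involution) -/

/-- **`|G| = 4pᵏ` with an element `u` generating a subgroup of index two, ANY central involution `c`: `μ(G, c) = φ₂(G, c)`** — if `c ∉ ⟨u⟩` then `⟨u⟩`
is a complement of `c` (seat b23 gen 40ʼs law); if `c ∈ ⟨u⟩` then `c = u^{pᵏ}` and the level-`pᵏ` trichotomy applies.  This is the form a field seat uses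
for «`F` cyclic over a quadratic subfield». [folklore] -/
theorem isLeast_card_gfaces_generate_fibreTwo_of_card_eq_four_mul_prime_pow_of_index_two {G : Type*} [Group G] [Fintype G] [DecidableEq G]
    {c : G} (hc2 : c * c = 1) (hc1 : c ≠ 1) (hcen : ∀ x : G, x * c = c * x) {p k : ℕ} (hp : p.Prime) (hp2 : p ≠ 2) (hk : k ≠ 0)
    (hcard : Fintype.card G = 4 * p ^ k) (u : G) (hindex : (Subgroup.zpowers u).index = 2) :
    IsLeast {m : ℕ | ∃ S : Finset (CMF G c →₀ ℤ), ↑S ⊆ gfaceSet G c hc2 ∧ S.card = m ∧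
      hodgeSpan c hc2 ≤ Submodule.span ℤ (pairSet c) ⊔ Submodule.span ℤ (translates c S)} (fibreTwo c hc2) := by
  have hp1 : 3 ≤ p := by
    have := hp.two_le
    omega
  have hpk : 0 < p ^ k := by positivity
  have hord : orderOf u = 2 * p ^ k := by
    have h := (Subgroup.zpowers u).card_mul_index
    rw [hindex, Nat.card_zpowers, Nat.card_eq_fintype_card, hcard] at h
    omega
  by_cases hcu : c ∈ Subgroup.zpowers u
  · have hun : u ^ p ^ k = c := (eq_pow_of_mem_zpowers_of_mul_self hord hcu hc2 hc1).symm
    have h2 : 2 ≤ p ^ k := by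
      calc 2 ≤ p := by omega
        _ = p ^ 1 := (pow_one p).symm
        _ ≤ p ^ k := Nat.pow_le_pow_right hp.pos (Nat.one_le_iff_ne_zero.mpr hk)
    rcases exists_involution_or_isCyclic_or_quaternion_of_prime_pow u hp hp2 hk hord hindex with
      ⟨w, hw, hww⟩ | hcyc | ⟨w, hw, hww, hwu⟩
    · exact isLeast_card_gfaces_generate_fibreTwo_of_involution_odd hc2 hc1 u w (hp.odd_of_ne_two hp2).pow hun hord hindex hw hww
    · haveI : IsCyclic G := hcyc
      exact isLeast_card_gfaces_generate_fibreTwo_of_isCyclic hc2 hc1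
    · exact isLeast_card_gfaces_generate_fibreTwo_of_quaternion hc2 u w hun hord hindex hw (hww.trans hun) hwu h2
  · exact ComplementFaces.isLeast_card_gfaces_generate_fibreTwo_of_cpl c (cpl_of_index_two c hindex hcu) hc2 hc1 hcen

end Summit.HodgeConjecture.CorCM.Census.IndexTwoCyclic
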